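import Summits.QuantumFields.YangMills.Theorems.BalabanUVNodesN13UVRowOfUpperAndSmallLocus

/-!
# BalabanUVNodes ∕ N13 — [III] COR. 3 AND K1⁷'s (B) CONJUNCT AT THE RECORD FROM THEOREM 1 + (U1) + (U2) + (L2ˢ): dag-n13-w3's p592785 ∕ p594664 headlines with the all-small
# term's lower bound (L2) demanded ONLY ON THE SMALL LOCUS `{V : every b₀-free plaquette (2εreg + 4ε₂₉)-small}` (off it the lower half of (0.1) is p593634's sign bookkeeping)

Cell `pub-ymgap` (HUMAN RULING D-0062 Track A; D-0149 width seat `pub-ymgap-dag-n13-w1`, g2, INTENT-6), key K1⁷ `StabilityBAtRecordR13SepCoPH` = stmt-QuantumFields-20542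
(`--kind proof --supports … --as helper`).  [III] = [Balaban1988Convergent], [B16] = [Balaban1989LargeFieldII], [Av] = [Balaban1985Averaging].

WHAT THIS FILE PROVES (theorems only, 0 `def`), at a v1.7 parameter `θ : Stage13HParams` under its CORE provisos `h : θ.Provisos₁₃CoPH` (ζ-laws ⇒ (L1); (H) by construction), `εreg` in
[Av] Prop. 2's range (K-uniform numerals):
* `uvIneq_at_record₁₃CoPH_of_U1_U2_L2small` — ONE RUN, ONE STEP: [B16] (0.1) ∕ [III] (2.50) `B16.UVIneq ((datumOfRecord₁₃CoPH θ h).C P) k V Em Ep` at EVERY `V` from (U1), (U2) and (L2ˢ) = the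
  all-small term's lower bound at the `V` of the small locus only.
* ★★ `cor3With_datumOfRecord₁₃CoPH_of_U1_U2_L2small` — `B16.Cor3With (datumOfRecord₁₃CoPH θ h).C γ em ep` from `SLaw` on `]0, γ]` + (U1) + (U2) + (L2ˢ) (dag-n13-w3's
  `cor3With_…_of_U1_U2_L2` with (L2) restricted).
* ★★★ `endStatementBPrinted_datumOfRecord₁₃CoPH_of_thm1_of_U1_U2_L2small` — K1⁷'s (B) conjunct `B16.EndStatementBPrinted ((datumOfRecord₁₃CoPH θ h).C)` from THEOREM 1 AT THE RECORD
  (a hypothesis: N11∕N13's 𝐑-row product) + (U1) + (U2) + (L2ˢ) on some `]0, γ]` — p. 355's «as an immediate consequence … the ultraviolet stability bounds» at NODE 00's record with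
  leaves (H), (L1) theorems and (L2) cut down to the small-field locus.

HONEST FRAMING.  Count-neutral by-name composition (p593634 `uvLower_of_smallLocus` ∕ `histTerm_nonneg`, p595529 `le_m_add_K_of_le`, p592785 `densOfRecord₁₃_le_of_U1_U2` ∕ `densOfRecord₁₃_eq_sum` ∕
`sLaw₁₃CoPH_of_thm1`, n24-c's `uvIneq_at_record₁₃CoPH_iff`, adv3's `B14Cor3.ge_of_sum_repr` ∕ `inInterval_of_le`); (U1), (U2), (L2ˢ) and Theorem 1 at the record DISPLAYED — nothing of
[B16] Thm 1 ∕ [III] Cor. 3 ∕ Thm 2 claimed; N13 NOT discharged; K0⁷∕K1⁷ NOT closed (its ∃θ, guard, admissibility and window live elsewhere); counts unmoved (5∕27 · A 5∕28); one finite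
`𝕋⁴_{L^K}` programme at fixed `ε = L^{−K}` — R4 closes the conditional finite-𝕋⁴ rung `BalabanLadder.UV` only; the YM mass gap (Clay) is NOT proved by any of this.  No `def`, no `sorry`.
-/

noncomputable section

open scoped BigOperators Matrix.Norms.L2Operator

namespace Summit.QuantumFields.YangMills.BalabanUVNodes.N13Cor3AtRecordOfU1U2L2SmallLocus

open Literature.MathematicalPhysics.QuantumFieldTheory.Balaban1983to89
open Literature.MathematicalPhysics.QuantumFieldTheory.Balaban1983to89.T4Continuum (T4Family)
open Literature.MathematicalPhysics.QuantumFieldTheory.Balaban1983to89.Node00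
open ExpMeanLog (deltaSU)
open B14Cor3 (ge_of_sum_repr inInterval_of_le)
open B16NodeKnitRecord13CoPH (uvIneq_at_record₁₃CoPH_iff)
open Summit.QuantumFields.YangMills.BalabanUVNodes.N13Cor3Repr218LeavesAtRecord13CoPH (densOfRecord₁₃_le_of_U1_U2 densOfRecord₁₃_eq_sum sLaw₁₃CoPH_of_thm1)
open Summit.QuantumFields.YangMills.BalabanUVNodes.N13UVChiOffSolvableAtRecord13 (histTerm_nonneg uvLower_of_smallLocus)
open Summit.QuantumFields.YangMills.BalabanUVNodes.N13UVRowOfUpperAndSmallLocus (le_m_add_K_of_le)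

variable {F : T4Family} {N : ℕ} [NeZero N] (θ : Stage13HParams F N) (h : θ.Provisos₁₃CoPH F N)

/-- **ONE RUN, ONE STEP: (0.1) ∕ (2.50) AT THE RECORD AT EVERY `V` FROM (U1) + (U2) + (L2ˢ)** — (L2) demanded only where every `b₀`-free plaquette of `V` is `(2εreg + 4ε₂₉)`-small; at the other
`V` the (2.9) species vanishes and `ρ_k ≥ 0` (p593634).  `εreg` in [Av] Prop. 2's range, `k ≤ P.K`. [cite: Balaban1989LargeFieldII, (0.1) pp.355–356; Balaban1988Convergent, (2.18) p.257, Cor. 3 (2.50) p.264; Balaban1987RG1, (2.9) p.266; Balaban1985Averaging, Prop. 2 (54) p.26] -/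
theorem uvIneq_at_record₁₃CoPH_of_U1_U2_L2small (hε : 0 < θ.ν.εreg) (hε3 : (143 * ((((4 + 4 : ℕ) : ℝ)) ^ 2 / 4) ^ 2) * θ.ν.εreg ≤ 1 / 3)
    (hε2 : 2 * θ.ν.εreg ≤ 2 * deltaSU (Fin N) / ((((4 + 4) * F.L : ℕ) : ℝ) ^ 2)) (P : B12.RunParams) {k : ℕ} (hk : k ≤ P.K)
    (major : (reprOfRecord₁₃ F N θ.toStage13Params P k).Adm → ℝ) (s₀ : (reprOfRecord₁₃ F N θ.toStage13Params P k).Adm) (Em Ep : ℝ)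
    (hU1 : ∀ s V, (reprOfRecord₁₃ F N θ.toStage13Params P k).χ s V * (reprOfRecord₁₃ F N θ.toStage13Params P k).TexpA s V ≤ major s)
    (hU2 : ∑ s, major s ≤ Real.exp (Ep * (Fintype.card (Site (F.P P.K) k) : ℝ)))
    (hL2small : ∀ V : GaugeField (F.P P.K) k (SU N),
      (∀ p : Plaq (F.P P.K) k, ¬ IsB0 (F := F) (⟨p.src, p.μ⟩ : PBond (F.P P.K) k) → ¬ IsB0 (F := F) (⟨p.src.shift p.μ, p.ν⟩ : PBond (F.P P.K) k) →
        ¬ IsB0 (F := F) (⟨p.src.shift p.ν, p.μ⟩ : PBond (F.P P.K) k) → ¬ IsB0 (F := F) (⟨p.src, p.ν⟩ : PBond (F.P P.K) k) →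
        dist1 (GaugeField.plaqHol V p) < 2 * θ.ν.εreg + 4 * θ.ε₂₉) →
      chiβOfRecord₁₃ F N θ.toStage13Params P.K (gOfRecord₁₃ F N θ.toStage13Params P) k V *
          Real.exp (-(1 / (gOfRecord₁₃ F N θ.toStage13Params P k) ^ 2 * wilsonBGOfRecord F N θ.εbg P k V) - Em * (Fintype.card (Site (F.P P.K) k) : ℝ)) ≤
        (reprOfRecord₁₃ F N θ.toStage13Params P k).χ s₀ V * (reprOfRecord₁₃ F N θ.toStage13Params P k).TexpA s₀ V) :
    ∀ V : GaugeField (F.P P.K) k (SU N), B16.UVIneq ((datumOfRecord₁₃CoPH F N θ h).C P) k V Em Ep :=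
  fun V => (uvIneq_at_record₁₃CoPH_iff F N θ h P k V Em Ep).2
    ⟨uvLower_of_smallLocus θ.toStage13Params h.zetaUnity h.zetaAbs hε P (le_m_add_K_of_le hk) hε3 hε2 Em
        (fun U hsmall => ge_of_sum_repr
          (fun s => (reprOfRecord₁₃ F N θ.toStage13Params P k).χ s U * (reprOfRecord₁₃ F N θ.toStage13Params P k).TexpA s U) s₀
          (densOfRecord₁₃_eq_sum F N θ P k U) (fun s => histTerm_nonneg θ.toStage13Params h.zetaUnity h.zetaAbs P k s U) (hL2small U hsmall)) V,
      densOfRecord₁₃_le_of_U1_U2 F N θ P k major Ep hU1 hU2 V⟩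

/-- **★★ `B16.Cor3With` AT THE RECORD ON `]0, γ]` FROM `SLaw` THERE + (U1) + (U2) + (L2ˢ)** — dag-n13-w3's `cor3With_datumOfRecord₁₃CoPH_of_U1_U2_L2` with (L2) RESTRICTED TO THE SMALL LOCUS.
[cite: Balaban1988Convergent, Cor. 3 (2.50) p.264; Balaban1989LargeFieldII, Thm 1 p.355, (0.1) pp.355–356; Balaban1985Averaging, Prop. 2 (54) p.26] -/
theorem cor3With_datumOfRecord₁₃CoPH_of_U1_U2_L2small (hε : 0 < θ.ν.εreg) (hε3 : (143 * ((((4 + 4 : ℕ) : ℝ)) ^ 2 / 4) ^ 2) * θ.ν.εreg ≤ 1 / 3)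
    (hε2 : 2 * θ.ν.εreg ≤ 2 * deltaSU (Fin N) / ((((4 + 4) * F.L : ℕ) : ℝ) ^ 2)) (γ : ℝ) (em ep : ℝ → ℝ)
    (major : (P : B12.RunParams) → (k : ℕ) → (reprOfRecord₁₃ F N θ.toStage13Params P k).Adm → ℝ)
    (s₀ : (P : B12.RunParams) → (k : ℕ) → (reprOfRecord₁₃ F N θ.toStage13Params P k).Adm)
    (hS : ∀ P : B12.RunParams, ((datumOfRecord₁₃CoPH F N θ h).C P).flow.InInterval γ P.K → ∀ k, k ≤ P.K → SLaw₁₃CoPH F N θ P k)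
    (hU1 : ∀ P : B12.RunParams, ((datumOfRecord₁₃CoPH F N θ h).C P).flow.InInterval γ P.K → ∀ k, k ≤ P.K → SLaw₁₃CoPH F N θ P k →
      ∀ s V, (reprOfRecord₁₃ F N θ.toStage13Params P k).χ s V * (reprOfRecord₁₃ F N θ.toStage13Params P k).TexpA s V ≤ major P k s)
    (hU2 : ∀ P : B12.RunParams, ((datumOfRecord₁₃CoPH F N θ h).C P).flow.InInterval γ P.K → ∀ k, k ≤ P.K → SLaw₁₃CoPH F N θ P k →
      ∑ s, major P k s ≤ Real.exp (ep (gOfRecord₁₃ F N θ.toStage13Params P k) * (Fintype.card (Site (F.P P.K) k) : ℝ)))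
    (hL2small : ∀ P : B12.RunParams, ((datumOfRecord₁₃CoPH F N θ h).C P).flow.InInterval γ P.K → ∀ k, k ≤ P.K → SLaw₁₃CoPH F N θ P k →
      ∀ V : GaugeField (F.P P.K) k (SU N),
        (∀ p : Plaq (F.P P.K) k, ¬ IsB0 (F := F) (⟨p.src, p.μ⟩ : PBond (F.P P.K) k) → ¬ IsB0 (F := F) (⟨p.src.shift p.μ, p.ν⟩ : PBond (F.P P.K) k) →
          ¬ IsB0 (F := F) (⟨p.src.shift p.ν, p.μ⟩ : PBond (F.P P.K) k) → ¬ IsB0 (F := F) (⟨p.src, p.ν⟩ : PBond (F.P P.K) k) →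
          dist1 (GaugeField.plaqHol V p) < 2 * θ.ν.εreg + 4 * θ.ε₂₉) →
        chiβOfRecord₁₃ F N θ.toStage13Params P.K (gOfRecord₁₃ F N θ.toStage13Params P) k V *
            Real.exp (-(1 / (gOfRecord₁₃ F N θ.toStage13Params P k) ^ 2 * wilsonBGOfRecord F N θ.εbg P k V)
              - em (gOfRecord₁₃ F N θ.toStage13Params P k) * (Fintype.card (Site (F.P P.K) k) : ℝ)) ≤
          (reprOfRecord₁₃ F N θ.toStage13Params P k).χ (s₀ P k) V * (reprOfRecord₁₃ F N θ.toStage13Params P k).TexpA (s₀ P k) V) :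
    B16.Cor3With (datumOfRecord₁₃CoPH F N θ h).C γ em ep := by
  intro P hP k hk V
  have hs : SLaw₁₃CoPH F N θ P k := hS P hP k hk
  exact uvIneq_at_record₁₃CoPH_of_U1_U2_L2small θ h hε hε3 hε2 P hk (major P k) (s₀ P k) _ _ (hU1 P hP k hk hs) (hU2 P hP k hk hs) (hL2small P hP k hk hs) V

/-- **★★★ K1⁷'s (B) CONJUNCT AT THE RECORD FROM THEOREM 1 AT THE RECORD + (U1) + (U2) + (L2ˢ) ON SOME `]0, γ]`** (on `]0, min γ γ₁]` both Theorem 1's `SLaw` and the leaves apply):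
`B16.EndStatementBPrinted ((datumOfRecord₁₃CoPH θ h).C)` with leaves (H), (L1) theorems at the record and (L2) cut down to the small-field locus.  CONDITIONAL; nothing of Bałaban's asserted;
K1⁷ NOT closed. [cite: Balaban1989LargeFieldII, Thm 1 p.355, (0.1) pp.355–356, p.391; Balaban1988Convergent, Cor. 3 (2.50) p.264; Balaban1985Averaging, Prop. 2 (54) p.26] -/
theorem endStatementBPrinted_datumOfRecord₁₃CoPH_of_thm1_of_U1_U2_L2small (hε : 0 < θ.ν.εreg) (hε3 : (143 * ((((4 + 4 : ℕ) : ℝ)) ^ 2 / 4) ^ 2) * θ.ν.εreg ≤ 1 / 3)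
    (hε2 : 2 * θ.ν.εreg ≤ 2 * deltaSU (Fin N) / ((((4 + 4) * F.L : ℕ) : ℝ) ^ 2)) (γ : ℝ) (hγ : 0 < γ) (em ep : ℝ → ℝ)
    (major : (P : B12.RunParams) → (k : ℕ) → (reprOfRecord₁₃ F N θ.toStage13Params P k).Adm → ℝ)
    (s₀ : (P : B12.RunParams) → (k : ℕ) → (reprOfRecord₁₃ F N θ.toStage13Params P k).Adm)
    (h1 : B16.Thm1Printed (datumOfRecord₁₃CoPH F N θ h).C)
    (hU1 : ∀ P : B12.RunParams, ((datumOfRecord₁₃CoPH F N θ h).C P).flow.InInterval γ P.K → ∀ k, k ≤ P.K → SLaw₁₃CoPH F N θ P k →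
      ∀ s V, (reprOfRecord₁₃ F N θ.toStage13Params P k).χ s V * (reprOfRecord₁₃ F N θ.toStage13Params P k).TexpA s V ≤ major P k s)
    (hU2 : ∀ P : B12.RunParams, ((datumOfRecord₁₃CoPH F N θ h).C P).flow.InInterval γ P.K → ∀ k, k ≤ P.K → SLaw₁₃CoPH F N θ P k →
      ∑ s, major P k s ≤ Real.exp (ep (gOfRecord₁₃ F N θ.toStage13Params P k) * (Fintype.card (Site (F.P P.K) k) : ℝ)))
    (hL2small : ∀ P : B12.RunParams, ((datumOfRecord₁₃CoPH F N θ h).C P).flow.InInterval γ P.K → ∀ k, k ≤ P.K → SLaw₁₃CoPH F N θ P k →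
      ∀ V : GaugeField (F.P P.K) k (SU N),
        (∀ p : Plaq (F.P P.K) k, ¬ IsB0 (F := F) (⟨p.src, p.μ⟩ : PBond (F.P P.K) k) → ¬ IsB0 (F := F) (⟨p.src.shift p.μ, p.ν⟩ : PBond (F.P P.K) k) →
          ¬ IsB0 (F := F) (⟨p.src.shift p.ν, p.μ⟩ : PBond (F.P P.K) k) → ¬ IsB0 (F := F) (⟨p.src, p.ν⟩ : PBond (F.P P.K) k) →
          dist1 (GaugeField.plaqHol V p) < 2 * θ.ν.εreg + 4 * θ.ε₂₉) →
        chiβOfRecord₁₃ F N θ.toStage13Params P.K (gOfRecord₁₃ F N θ.toStage13Params P) k V *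
            Real.exp (-(1 / (gOfRecord₁₃ F N θ.toStage13Params P k) ^ 2 * wilsonBGOfRecord F N θ.εbg P k V)
              - em (gOfRecord₁₃ F N θ.toStage13Params P k) * (Fintype.card (Site (F.P P.K) k) : ℝ)) ≤
          (reprOfRecord₁₃ F N θ.toStage13Params P k).χ (s₀ P k) V * (reprOfRecord₁₃ F N θ.toStage13Params P k).TexpA (s₀ P k) V) :
    B16.EndStatementBPrinted (datumOfRecord₁₃CoPH F N θ h).C := by
  obtain ⟨γ₁, hγ₁, H1⟩ := sLaw₁₃CoPH_of_thm1 F N θ h h1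
  refine ⟨h1, min γ γ₁, lt_min hγ hγ₁, em, ep, ?_⟩
  refine cor3With_datumOfRecord₁₃CoPH_of_U1_U2_L2small θ h hε hε3 hε2 (min γ γ₁) em ep major s₀ ?_ ?_ ?_ ?_
  · exact fun P hP k hk => H1 P (inInterval_of_le hP (min_le_right γ γ₁)) k hk
  · exact fun P hP => hU1 P (inInterval_of_le hP (min_le_left γ γ₁))
  · exact fun P hP => hU2 P (inInterval_of_le hP (min_le_left γ γ₁))
  · exact fun P hP => hL2small P (inInterval_of_le hP (min_le_left γ γ₁))

end Summit.QuantumFields.YangMills.BalabanUVNodes.N13Cor3AtRecordOfU1U2L2SmallLocus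

end
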